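import Mathlib
import Literature.Computability.Complexity.SymmetricCircuit
import Summits.PneNP.PneNP.Theorems.SymmetryBudgetWindowBarrierStubHeaderHardwiring
import Summits.PneNP.PneNP.Theorems.SymmetryBudgetWindowBarrierRelocation

/-!
# Window fooling implies core fooling (crux `SymmetryBudget.WindowBarrier`, item stmt-PneNP-2145,
stub S4 / core (★)) — the converse bridge to `SymmetryBudgetWindowBarrierCoreReduction.lean`

`CoreReduction.exists_core_circuit` turns a `Bud(n+g, g)`-symmetric circuit on `(n+g) × (n+g)` inputs
into a `Sym(Fin g)`-symmetric circuit on `g × g` inputs with the same values on planted matrices (so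
core fooling ⇒ window fooling). Here the other direction: a `Sym(Fin g)`-symmetric circuit `D` on
`g × g` inputs, read through the free block (`(j, j') ↦ (n + j, n + j')`, relocation with EMPTY
prefix, `CoreReduction.exists_isInducedAut_hardwire₂`), is a `Bud(n+g, g)`-symmetric circuit of the
same size taking on the planted matrix of `G` the value of `D` on the adjacency matrix of `G`. Hence
if the planted matrices of `G₁, G₂` fool all `Bud`-symmetric `tcBasis`-circuits of size `≤ s`, then
`G₁, G₂` fool all square-symmetric `tcBasis`-circuits of size `≤ s` (`coreFooling_of_windowFooling`):
S4-witnesses in planted form are exactly (★)-witnesses, and every formal filter for (★) (the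
materialisation theorems) applies to them.
-/

-- `Summit.PneNP.PneNP.…` duplicates `PneNP` BY DESIGN (single-problem summit).
set_option linter.dupNamespace false

namespace Summit.PneNP.PneNP.Theorems

open Literature.Computability.Complexity Literature.Computability.Complexity.GateList
open scoped Classical

namespace CoreBridge

variable {n g : ℕ}

/-- Bound of a free index. -/
theorem free_lt (n : ℕ) (j : Fin g) : n + (j : ℕ) < n + g := by omega

/-- **Restriction of a budget permutation to the free block.** Every `ρ ∈ Bud(n+g, g)` maps free
indices to free indices; its restriction is a permutation `σ` of `Fin g` with `ρ (n + j) = n + σ j`. -/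
theorem exists_restrict (ρ : Equiv.Perm (Fin (n + g))) (hρ : ρ ∈ pointStabiliserBudget (n + g) g) :
    ∃ σ : Equiv.Perm (Fin g), ∀ j : Fin g, ρ ⟨n + j, free_lt n j⟩ = ⟨n + σ j, free_lt n (σ j)⟩ := by
  have hfix : ∀ i : Fin (n + g), (i : ℕ) < n → ρ i = i := fun i hi => hρ i (by omega)
  have hfree : ∀ i : Fin (n + g), n ≤ (i : ℕ) → n ≤ ((ρ i : Fin (n+g)) : ℕ) := by
    intro i hi
    by_contra hlt
    have h1 : ρ (ρ i) = ρ i := hfix (ρ i) (by omega)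
    have h2 : ρ i = i := ρ.injective h1
    rw [h2] at hlt
    exact hlt hi
  have hfree' : ∀ i : Fin (n + g), n ≤ (i : ℕ) → n ≤ ((ρ.symm i : Fin (n+g)) : ℕ) := by
    intro i hi
    by_contra hlt
    have h1 : ρ (ρ.symm i) = ρ.symm i := hfix (ρ.symm i) (by omega)
    rw [Equiv.apply_symm_apply] at h1
    rw [h1] at hi
    exact hlt hi
  let t : Fin g → Fin g := fun j => ⟨((ρ ⟨n + j, free_lt n j⟩ : Fin (n+g)) : ℕ) - n, by
    have := (ρ ⟨n + j, free_lt n j⟩).2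
    have := hfree ⟨n + j, free_lt n j⟩ (by simp); omega⟩
  let t' : Fin g → Fin g := fun j => ⟨((ρ.symm ⟨n + j, free_lt n j⟩ : Fin (n+g)) : ℕ) - n, by
    have := (ρ.symm ⟨n + j, free_lt n j⟩).2
    have := hfree' ⟨n + j, free_lt n j⟩ (by simp); omega⟩
  have ht : ∀ j : Fin g, ρ ⟨n + j, free_lt n j⟩ = ⟨n + t j, free_lt n (t j)⟩ := by
    intro j
    apply Fin.ext
    have hf := hfree ⟨n + j, free_lt n j⟩ (by simp)
    simp [t]
    omega
  have ht' : ∀ j : Fin g, ρ.symm ⟨n + j, free_lt n j⟩ = ⟨n + t' j, free_lt n (t' j)⟩ := by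
    intro j
    apply Fin.ext
    have hf := hfree' ⟨n + j, free_lt n j⟩ (by simp)
    simp [t']
    omega
  have hinj : ∀ {j j' : Fin g}, (⟨n + j, free_lt n j⟩ : Fin (n + g)) = ⟨n + j', free_lt n j'⟩ → j = j' := by
    intro j j' h
    simp only [Fin.mk.injEq] at h
    exact Fin.ext (by omega)
  refine ⟨{ toFun := t, invFun := t',
            left_inv := fun j => ?_, right_inv := fun j => ?_ }, ht⟩
  · have h1 := ht' (t j)
    rw [← ht j, Equiv.symm_apply_apply] at h1
    exact (hinj h1).symm
  · have h1 := ht (t' j)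
    rw [← ht' j, Equiv.apply_symm_apply] at h1
    exact (hinj h1).symm

/-- **Reading a core circuit through the free block.** For a `Sym(Fin g)`-symmetric `tcBasis`-circuit
`D` on `g × g` inputs there is a `Bud(n+g, g)`-symmetric `tcBasis`-circuit of the same size on
`(n+g) × (n+g)` inputs whose value on `x` is `D (fun (j, j') => x (n+j, n+j'))`. -/
theorem exists_window_circuit (n g : ℕ) (D : Circuit (Fin g × Fin g)) (hB : D.IsOver tcBasis)
    (hsym : D.IsSymmetricUnder Set.univ) :
    ∃ C : Circuit (Fin (n + g) × Fin (n + g)), C.IsOver tcBasis ∧ C.size = D.size ∧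
      C.IsSymmetricUnder (pointStabiliserBudget (n + g) g) ∧
      ∀ x : Fin (n + g) × Fin (n + g) → Bool,
        C.eval x = D.eval (fun p : Fin g × Fin g => x (⟨n + p.1, free_lt n p.1⟩, ⟨n + p.2, free_lt n p.2⟩)) := by
  let φ : Fin g × Fin g → (Fin (n + g) × Fin (n + g)) ⊕ ℕ :=
    fun p => Sum.inl (⟨n + p.1, free_lt n p.1⟩, ⟨n + p.2, free_lt n p.2⟩)
  have hφ : WiresOK ([] : List (Gate (Fin (n + g) × Fin (n + g)))).length φ := fun _ _ h => by cases h
  obtain ⟨C, hCg, hCo⟩ := CoreReduction.exists_hardwire₂ [] WF.nil D φ hφ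
  refine ⟨C, CoreReduction.isOver_hardwire₂ [] (fun _ h => by cases h) D C hB φ _ hCg, ?_, ?_, ?_⟩
  · rw [CoreReduction.size_hardwire₂ [] D C φ _ hCg]
    rfl
  · intro ρ hρ
    obtain ⟨σ, hσ⟩ := exists_restrict ρ hρ
    obtain ⟨τ, hτ⟩ := hsym σ (Set.mem_univ _)
    exact CoreReduction.exists_isInducedAut_hardwire₂ [] (fun _ h => by cases h) D C φ hφ hCg hCo
      (π := fun p : Fin g × Fin g => (σ p.1, σ p.2))
      (π' := fun q : Fin (n + g) × Fin (n + g) => (ρ q.1, ρ q.2))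
      (fun p => by simp only [φ, Sum.map_inl, hσ]) hτ
  · intro x
    rw [CoreReduction.eval_hardwire₂ [] D C φ hφ hCg hCo x]
    rfl

end CoreBridge

open CoreBridge in
/-- **Window fooling implies core fooling.** If two `(n+g) × (n+g)` matrices `x₁, x₂` that agree
with the planted adjacency matrices of `G₁, G₂` on the free block fool every `Bud(n+g, g)`-symmetric
`tcBasis`-circuit of size `≤ s`, then `G₁, G₂` fool every `Sym(Fin g)`-symmetric (square-symmetric)
`tcBasis`-circuit of size `≤ s`. So S4-witnesses in planted form are (★)-witnesses, and the
materialisation filters apply to them. -/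
theorem coreFooling_of_windowFooling (n g s : ℕ) (G₁ G₂ : SimpleGraph (Fin g))
    (x₁ x₂ : Fin (n + g) × Fin (n + g) → Bool)
    (hx₁ : ∀ j j' : Fin g, x₁ (⟨n + j, free_lt n j⟩, ⟨n + j', free_lt n j'⟩) = decide (G₁.Adj j j'))
    (hx₂ : ∀ j j' : Fin g, x₂ (⟨n + j, free_lt n j⟩, ⟨n + j', free_lt n j'⟩) = decide (G₂.Adj j j'))
    (hfool : ∀ C : Circuit (Fin (n + g) × Fin (n + g)), C.IsOver tcBasis → C.size ≤ s →
      C.IsSymmetricUnder (pointStabiliserBudget (n + g) g) → C.eval x₁ = C.eval x₂) :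
    ∀ D : Circuit (Fin g × Fin g), D.IsOver tcBasis → D.size ≤ s → D.IsSymmetricUnder Set.univ →
      D.eval (fun p : Fin g × Fin g => decide (G₁.Adj p.1 p.2)) =
        D.eval (fun p : Fin g × Fin g => decide (G₂.Adj p.1 p.2)) := by
  intro D hB hs hsym
  obtain ⟨C, hCB, hCs, hCsym, hCev⟩ := exists_window_circuit n g D hB hsym
  have h := hfool C hCB (by rw [hCs]; exact hs) hCsym
  rw [hCev, hCev] at h
  have e1 : (fun p : Fin g × Fin g => x₁ (⟨n + p.1, free_lt n p.1⟩, ⟨n + p.2, free_lt n p.2⟩)) =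
      fun p : Fin g × Fin g => decide (G₁.Adj p.1 p.2) := funext fun p => hx₁ p.1 p.2
  have e2 : (fun p : Fin g × Fin g => x₂ (⟨n + p.1, free_lt n p.1⟩, ⟨n + p.2, free_lt n p.2⟩)) =
      fun p : Fin g × Fin g => decide (G₂.Adj p.1 p.2) := funext fun p => hx₂ p.1 p.2
  rw [e1, e2] at h
  exact h

/-- **Registered sub-goal `stub_coreBridge`** (crux stmt-PneNP-2145): window fooling ⇒ core fooling,
alias of `coreFooling_of_windowFooling`. -/
theorem stub_coreBridge : ∀ (n g s : ℕ) (G₁ G₂ : SimpleGraph (Fin g)) (x₁ x₂ : Fin (n + g) × Fin (n + g) → Bool), (∀ j j' : Fin g, x₁ (⟨n + j, by omega⟩, ⟨n + j', by omega⟩) = decide (G₁.Adj j j')) → (∀ j j' : Fin g, x₂ (⟨n + j, by omega⟩, ⟨n + j', by omega⟩) = decide (G₂.Adj j j')) → (∀ C : Circuit (Fin (n + g) × Fin (n + g)), C.IsOver tcBasis → C.size ≤ s → C.IsSymmetricUnder (pointStabiliserBudget (n + g) g) → C.eval x₁ = C.eval x₂) → ∀ D : Circuit (Fin g × Fin g),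 D.IsOver tcBasis → D.size ≤ s → D.IsSymmetricUnder Set.univ → D.eval (fun p : Fin g × Fin g => decide (G₁.Adj p.1 p.2)) = D.eval (fun p : Fin g × Fin g => decide (G₂.Adj p.1 p.2)) :=
  fun n g s G₁ G₂ x₁ x₂ hx₁ hx₂ hfool => coreFooling_of_windowFooling n g s G₁ G₂ x₁ x₂ hx₁ hx₂ hfool

end Summit.PneNP.PneNP.Theorems
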